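import Literature.Barriers.CriticalPhenomena.RigorousRGSmallParameterPerturbativeBetaWMassive
import Literature.Barriers.CriticalPhenomena.RigorousRGSmallParameterPerturbativeCoefficientsMassDerivative
import HarnessLib

/-!
# `RigorousRGSmallParameter` (Slade, Theorem 1.4.1): Lemma 5.2.4 — `β^:_j(m²)` stays within `a/64`
# of `a` between the lattice scales and the mass scale

Fifteenth file of the §10.3–§10.4 layer and the end point of Lemma 5.2.1–5.2.4: the hypothesis
`|β^W_j - a| ≤ b_L (j < J_L), ≤ a/64 (J_L ≤ j)` that the abstract critical flow of
`RigorousRGSmallParameterFlowToMassScale.lean` (`Hyp.βW_le₁/₂`) takes as input, for the explicit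
coefficients `β^:_j(m²) = PT.betaWCoeff d n L α m² j` and `a = FRD.aCoeff d n L α`.
G. Slade, *Critical exponents for long-range `O(n)` models below the upper critical dimension*,
Commun. Math. Phys. **358** (2018), §5.2: "**Lemma 5.2.4.** Let `d = 1,2,3`; `α ∈ (d/2, 2∧d)`;
`m̄² > 0`. There exist `J_L` and `b_L` such that, uniformly in `m² ∈ [0,m̄²]` and `j ≤ j_m`, and with
the constant `a` of Lemma 5.2.2, (5.28) `|β^:_j(m²) - a| ≤ b_L (j ≤ J_L)`, `a/64 (J_L ≤ j ≤ j_m - J_L)`,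
`b_L (j_m - J_L ≤ j ≤ j_m)`. *Proof.* Let `j ≤ j_m`. By the triangle inequality, and by Lemmas 5.2.2
and 5.2.3, (5.29) `|β^:_j(m²) - a| ≤ |β^:_j(m²) - β_j(m²)| + |β_j(m²) - β_j(0)| + |β_j(0) - a| ≤
|β_j(m²) - β_j(0)| + b̄_LL^{-(α∧1)j} + b̿_L(L^{-zj} + L^{-z(j_m-j)})`. We choose `J_L` to be large enough
that `b̄_LL^{-(α∧1)j} + b̿_L(L^{-zj} + L^{-z(j_m-j)}) ≤ a/128`, for `J_L ≤ j ≤ j_m - J_L`. … To deal with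
the logarithmic factor in (5.23) for `d = 2`, we increase `r` slightly to absorb it. Then integration
of this modification of (5.23) gives (note that `1 - r > 0`) (5.30) `|β_j(m²) - β_j(0)| ≤
(1/(1-r))c_{∂β}(m²L^{αj})^{1-r}`. We write `m²L^{αj} = m²L^{αj_m}L^{-α(j_m-j)}` and use the
definition of `j_m` to see that (5.30) implies that there exists `b̂_L` such that (5.31)
`|β_j(m²) - β_j(0)| ≤ b̂_LL^{-α(1-r)(j_m-j)}`. By increasing `J_L` if necessary, the right-hand
side is at most `a/128` for `j ≤ j_m - J_L`, and in any case is at most `b̂_L`. This gives the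
desired result, with `b_L = b̂_L + b̄_L + b̿_L`."

Here for `0 < m² ≤ 1` (`m̄² = 1`; the massless value `β^:_j(0)` is within `C(j+1)(L^j)^{-(α∧1)}`
of `a` by `FRD.abs_betaWCoeff_sub_aCoeff_le_massless`): the bound `b_L` (`= c + a` from the uniform
bound `|β^:_j| ≤ c` of Lemma 5.2.1) holds for every `j`, and `a/64` for `J_L ≤ j`, `j + J_L ≤ j_m`.
The `d`-dependent input (5.23) enters through an abstract derivative bound `|∂β_j/∂m²| ≤
c_{∂β}L^{αj}(m²L^{αj})^{-r}`, `r < 1`, on `{m²(L^j)^α ≤ 1}`, discharged for `d = 1` (`α ∈ (½,1)`),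
`d = 2` and `d ≥ 3` (`α ∈ (1,2)`) by `PT.Slade2017_lem521_massDeriv_d1/_d2/_dge3`; (5.30) is the
comparison ("racetrack") form of the mean value inequality for `f ∓ (K/(1-r))s^{1-r}`.

## What this file proves (everything; no definition, no named fact)

* `FRD.abs_sub_le_of_abs_deriv_le_rpow` (`|f(b) - f(0)| ≤ (K/(1-r))b^{1-r}` from `|f'| ≤ Ks^{-r}`),
  `FRD.scaleMin_eq_of_massArg_le_one`, **`FRD.abs_betaCoeff_sub_massless_le`** ((5.30):
  `|β_j(m²) - β_j(0)| ≤ (c_{∂β}/(1-r))(m²L^{αj})^{1-r}`), `FRD.exists_forall_ge_le_of_tendsto_zero`.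
* **`FRD.Slade2017_lem524`** — **Lemma 5.2.4, PROVED** (abstract (5.23) input): `∃ J_L b_L`, for
  `0 < m² ≤ 1` and all `j`: `|β^:_j(m²) - a| ≤ b_L`, and `≤ a/64` if `J_L ≤ j`, `j + J_L ≤ j_m`.
* **`FRD.Slade2017_lem524_d1`**, **`FRD.Slade2017_lem524_d2`**, **`FRD.Slade2017_lem524_dge3`** — the
  same unconditionally for `d = 1` (`α ∈ (½,1)`), `d = 2`, `d ≥ 3` (`α ∈ (1,2)`).
-/

noncomputable section

namespace Literature.Barriers.CriticalPhenomena

open _root_.MeasureTheory Set Filter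
open scoped _root_.Topology Real

namespace LongRangePhi4

namespace FRD

open Literature.Probability.LatticeModels

variable {d : ℕ}

/-! ### Integration of a derivative bound `|f'(s)| ≤ Ks^{-r}`, `r < 1` -/

/-- If `f` is continuous on `[0,b]`, differentiable on `(0,b)` with `|f'(s)| ≤ Ks^{-r}` (`r < 1`),
then `|f(b) - f(0)| ≤ (K/(1-r))b^{1-r}` ("integration of (5.23) gives (note that `1-r > 0`)
`|β_j(m²) - β_j(0)| ≤ (1/(1-r))c_{∂β}(m²L^{αj})^{1-r}`"). [cite: Slade2017, Lemma 5.2.4 (proof, display (5.30))] -/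
theorem abs_sub_le_of_abs_deriv_le_rpow {f f' : ℝ → ℝ} {b K r : ℝ} (hb : 0 < b) (hr : r < 1)
    (hcont : ContinuousOn f (Icc 0 b))
    (hderiv : ∀ s ∈ Ioo 0 b, HasDerivAt f (f' s) s ∧ |f' s| ≤ K * s ^ (-r)) :
    |f b - f 0| ≤ K / (1 - r) * b ^ (1 - r) := by
  have h1r : 0 < 1 - r := by linarith
  set g : ℝ → ℝ := fun s => K / (1 - r) * s ^ (1 - r) with hg
  have hg0 : g 0 = 0 := by simp [hg, Real.zero_rpow h1r.ne']
  have hgc : ContinuousOn g (Icc 0 b) :=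
    (continuous_const.mul (Real.continuous_rpow_const h1r.le)).continuousOn
  have hgd : ∀ s ∈ Ioo (0 : ℝ) b, HasDerivAt g (K * s ^ (-r)) s := by
    intro s hs
    have hs0 : s ≠ 0 := hs.1.ne'
    have h := (Real.hasDerivAt_rpow_const (p := 1 - r) (Or.inl hs0)).const_mul (K / (1 - r))
    have e : K / (1 - r) * ((1 - r) * s ^ (1 - r - 1)) = K * s ^ (-r) := by
      rw [show (1 : ℝ) - r - 1 = -r by ring]; field_simp
    rw [e] at h
    exact h
  have hint : interior (Icc (0 : ℝ) b) = Ioo 0 b := interior_Icc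
  -- `f - g` is antitone, `f + g` is monotone on `[0,b]`
  have hanti : AntitoneOn (fun s => f s - g s) (Icc 0 b) := by
    refine antitoneOn_of_deriv_nonpos (convex_Icc 0 b) (hcont.sub hgc) ?_ ?_
    · rw [hint]
      intro s hs
      exact ((hderiv s hs).1.sub (hgd s hs)).differentiableAt.differentiableWithinAt
    · rw [hint]
      intro s hs
      have hd' : HasDerivAt (fun s => f s - g s) (f' s - K * s ^ (-r)) s := (hderiv s hs).1.sub (hgd s hs)
      rw [hd'.deriv]
      have := (hderiv s hs).2
      have := le_abs_self (f' s)
      linarith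
  have hmono : MonotoneOn (fun s => f s + g s) (Icc 0 b) := by
    refine monotoneOn_of_deriv_nonneg (convex_Icc 0 b) (hcont.add hgc) ?_ ?_
    · rw [hint]
      intro s hs
      exact ((hderiv s hs).1.add (hgd s hs)).differentiableAt.differentiableWithinAt
    · rw [hint]
      intro s hs
      have hd' : HasDerivAt (fun s => f s + g s) (f' s + K * s ^ (-r)) s := (hderiv s hs).1.add (hgd s hs)
      rw [hd'.deriv]
      have := (hderiv s hs).2
      have := neg_abs_le (f' s)
      linarith
  have h0 : (0 : ℝ) ∈ Icc 0 b := ⟨le_rfl, hb.le⟩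
  have hbm : b ∈ Icc 0 b := ⟨hb.le, le_rfl⟩
  have h1 := hanti h0 hbm hb.le
  have h2 := hmono h0 hbm hb.le
  simp only [hg0, sub_zero, add_zero] at h1 h2
  rw [abs_le]
  constructor <;> linarith

/-! ### `|β_j(m²) - β_j(0)|` from (5.23) -/

/-- Below the mass scale the prefactor of `β_j` is the massless one: if `m²(L^j)^α ≤ 1` (and
`0 ≤ m² ≤ 1`) then `j ∧ j_m = j`. [cite: Slade2017, §5.2 (display (5.18)) and §3.4 (mass scale)] -/
theorem scaleMin_eq_of_massArg_le_one {L α m2 : ℝ} (hL : 1 < L) (hα : 0 < α) (hm : 0 ≤ m2) (hm1 : m2 ≤ 1)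
    {j : ℕ} (hA : m2 * (L ^ j) ^ α ≤ 1) : PT.scaleMin L α m2 j = j := by
  rcases hm.eq_or_lt with h0 | h0
  · rw [← h0]; exact PT.scaleMin_of_not_pos (lt_irrefl 0) j
  · rw [PT.scaleMin_of_pos h0, min_eq_left]
    -- `A_j ≤ 1 < L^α ≤ A_{j_m}` forces `j < j_m`
    have hL0 : 0 < L := by linarith
    obtain ⟨hB1, -⟩ := massArg_massScale_bounds hL hα h0 hm1
    by_contra hlt
    rw [not_le] at hlt
    have hmono : m2 * (L ^ massScale L α m2) ^ α ≤ m2 * (L ^ j) ^ α := by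
      refine mul_le_mul_of_nonneg_left (Real.rpow_le_rpow (by positivity) ?_ hα.le) h0.le
      exact pow_le_pow_right₀ hL.le hlt.le
    have : (1 : ℝ) < L ^ α := Real.one_lt_rpow hL hα
    linarith

/-- **(5.30)–(5.31): `|β_j(m²) - β_j(0)| ≤ (c_{∂β}/(1-r))(m²L^{αj})^{1-r}`**, from a derivative bound
`|∂β_j/∂m²| ≤ c_{∂β}L^{αj}(m²L^{αj})^{-r}` on `{m²(L^j)^α ≤ 1}` with `r < 1` (the form of (5.23),
`PT.Slade2017_lem521_massDeriv_d1/_d2/_dge3`) and the continuity of `β_j` in `m²`.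
[cite: Slade2017, Lemma 5.2.4 (proof, displays (5.30)–(5.31))] -/
theorem abs_betaCoeff_sub_massless_le (hd : 1 ≤ d) (n : ℕ) {α : ℝ} (hα0 : 0 < α) (hα2 : α < 2)
    {L : ℝ} (hL : 2 ≤ L) {c r : ℝ} (hc : 0 < c) (hr : r < 1)
    (hD : ∀ m2 : ℝ, 0 < m2 → ∀ j : ℕ, m2 * (L ^ j) ^ α ≤ 1 →
      HasDerivAt (fun a : ℝ => PT.betaCoeff d n L α a j) (deriv (fun a : ℝ => PT.betaCoeff d n L α a j) m2) m2 ∧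
      |deriv (fun a : ℝ => PT.betaCoeff d n L α a j) m2| ≤ c * (L ^ α) ^ j * (m2 * (L ^ j) ^ α) ^ (-r))
    {m2 : ℝ} (hm : 0 < m2) (hm1 : m2 ≤ 1) {j : ℕ} (hA : m2 * (L ^ j) ^ α ≤ 1) :
    |PT.betaCoeff d n L α m2 j - PT.betaCoeff d n L α 0 j| ≤ c / (1 - r) * (m2 * (L ^ j) ^ α) ^ (1 - r) := by
  have hL1 : (1 : ℝ) < L := by linarith
  have hL0 : (0 : ℝ) < L := by linarith
  set ℓ : ℝ := (L ^ j) ^ α with hℓ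
  have hℓ0 : 0 < ℓ := Real.rpow_pos_of_pos (pow_pos hL0 j) _
  have hℓa : (L ^ α) ^ j = ℓ := (PT.pow_rpow_comm hL0.le j α).symm
  -- continuity on `[0, m2]`: there `β_j = L^{-εj} β'_j`
  have hcont : ContinuousOn (fun a : ℝ => PT.betaCoeff d n L α a j) (Icc 0 m2) := by
    have hc' : Continuous fun a : ℝ => ((L ^ (2 * α - d)) ^ j)⁻¹ * PT.betaPrime d n L α a j := by
      unfold PT.betaPrime
      exact continuous_const.mul (continuous_const.mul
        ((PT.continuous_powSum_wCov_mass hd hα0 hα2 hL (j + 1) two_ne_zero).sub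
          (PT.continuous_powSum_wCov_mass hd hα0 hα2 hL j two_ne_zero)))
    refine hc'.continuousOn.congr fun a ha => ?_
    have hAa : a * (L ^ j) ^ α ≤ 1 := le_trans (mul_le_mul_of_nonneg_right ha.2 hℓ0.le) hA
    unfold PT.betaCoeff
    rw [scaleMin_eq_of_massArg_le_one hL1 hα0 ha.1 (ha.2.trans hm1) hAa]
  have hderiv : ∀ s ∈ Ioo 0 m2, HasDerivAt (fun a : ℝ => PT.betaCoeff d n L α a j)
      (deriv (fun a : ℝ => PT.betaCoeff d n L α a j) s) s ∧
      |deriv (fun a : ℝ => PT.betaCoeff d n L α a j) s| ≤ c * ℓ * ℓ ^ (-r) * s ^ (-r) := by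
    intro s hs
    have hAs : s * (L ^ j) ^ α ≤ 1 := le_trans (mul_le_mul_of_nonneg_right hs.2.le hℓ0.le) hA
    obtain ⟨h1, h2⟩ := hD s hs.1 j hAs
    refine ⟨h1, h2.trans (le_of_eq ?_)⟩
    rw [hℓa, ← hℓ, Real.mul_rpow hs.1.le hℓ0.le]; ring
  have h := abs_sub_le_of_abs_deriv_le_rpow hm hr hcont hderiv
  refine h.trans (le_of_eq ?_)
  rw [Real.mul_rpow hm.le hℓ0.le]
  have e : ℓ * ℓ ^ (-r) = ℓ ^ (1 - r) := by
    rw [sub_eq_add_neg, Real.rpow_add hℓ0, Real.rpow_one]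
  rw [mul_assoc c ℓ, e]
  field_simp


/-! ### Lemma 5.2.4 -/

/-- Eventual smallness of a real sequence tending to `0`. [folklore] -/
theorem exists_forall_ge_le_of_tendsto_zero {u : ℕ → ℝ} (hu : Tendsto u atTop (𝓝 0)) {δ : ℝ} (hδ : 0 < δ) :
    ∃ N : ℕ, ∀ k : ℕ, N ≤ k → u k ≤ δ := by
  have h := (hu.eventually (Iio_mem_nhds hδ))
  obtain ⟨N, hN⟩ := eventually_atTop.1 h
  exact ⟨N, fun k hk => (hN k hk).le⟩

set_option maxHeartbeats 800000 in
/-- **Slade, Lemma 5.2.4, PROVED for the explicit decomposition** (given the `d`-dependent input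
(5.23) in the form `|∂β_j/∂m²| ≤ c_{∂β}L^{αj}(m²L^{αj})^{-r}`, `r < 1`, on `{m²L^{αj} ≤ 1}` — supplied
for `d = 1, 2, ≥ 3` by `PT.Slade2017_lem521_massDeriv_d1/_d2/_dge3`, see the corollaries below):
"Let … `m̄² > 0`. There exist `J_L` and `b_L` such that, uniformly in `m² ∈ [0,m̄²]` and `j ≤ j_m`,
and with the constant `a` of Lemma 5.2.2, (5.28) `|β^:_j(m²) - a| ≤ b_L` (`j ≤ J_L`), `a/64`
(`J_L ≤ j ≤ j_m - J_L`), `b_L` (`j_m - J_L ≤ j ≤ j_m`)." Here for `0 < m² ≤ 1`: the bound `b_L` holds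
for every `j`, and `a/64` for `J_L ≤ j ≤ j_m - J_L`. Proof as printed: `|β^:_j(m²) - a| ≤ |β^:_j - β_j|
+ |β_j(m²) - β_j(0)| + |β_j(0) - a|` with Lemmas 5.2.3, (5.30)–(5.31) and 5.2.2, and `J_L` large.
[cite: Slade2017, Lemma 5.2.4 (display (5.28)) and its proof (displays (5.29)–(5.31))] -/
theorem Slade2017_lem524 (hd : 1 ≤ d) (n : ℕ) {α : ℝ} (hα0 : 0 < α) (hα2 : α < 2) (hαd : α < d)
    {L : ℝ} (hL : 2 ≤ L) {c r : ℝ} (hc : 0 < c) (hr : r < 1)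
    (hD : ∀ m2 : ℝ, 0 < m2 → ∀ j : ℕ, m2 * (L ^ j) ^ α ≤ 1 →
      HasDerivAt (fun a : ℝ => PT.betaCoeff d n L α a j) (deriv (fun a : ℝ => PT.betaCoeff d n L α a j) m2) m2 ∧
      |deriv (fun a : ℝ => PT.betaCoeff d n L α a j) m2| ≤ c * (L ^ α) ^ j * (m2 * (L ^ j) ^ α) ^ (-r)) :
    ∃ JL : ℕ, ∃ bL : ℝ, 0 < bL ∧ ∀ m2 : ℝ, 0 < m2 → m2 ≤ 1 → ∀ j : ℕ,
      |PT.betaWCoeff d n L α m2 j - aCoeff d n L α| ≤ bL ∧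
      (JL ≤ j → j + JL ≤ massScale L α m2 →
        |PT.betaWCoeff d n L α m2 j - aCoeff d n L α| ≤ aCoeff d n L α / 64) := by
  have hL1 : (1 : ℝ) < L := by linarith
  have hL0 : (0 : ℝ) < L := by linarith
  obtain ⟨ha, C₂, hC₂, h522⟩ := Slade2017_lem522 hd n hα0 hα2 hαd hL
  obtain ⟨z, hz, C₃, hC₃, h523⟩ := Slade2017_lem523 hd n hα0 hα2 hαd hL
  obtain ⟨c₅, hc₅, hcore⟩ := PT.Slade2017_lem521_core hd n hα0 hα2 hαd (zero_le_one : (0 : ℝ) ≤ 1) hL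
  set a : ℝ := aCoeff d n L α with haDef
  set m : ℝ := min α 1 with hm
  have hm0 : 0 < m := lt_min hα0 one_pos
  have h1r : 0 < 1 - r := by linarith
  set ĉ : ℝ := c / (1 - r) with hĉ
  have hĉ0 : 0 < ĉ := div_pos hc h1r
  -- the three null sequences
  set q : ℝ := L ^ (-m) with hq
  have hq0 : 0 < q := Real.rpow_pos_of_pos hL0 _
  have hq1 : q < 1 := Real.rpow_lt_one_of_one_lt_of_neg hL1 (by linarith)
  have hu : Tendsto (fun j : ℕ => ((j : ℝ) + 1) * q ^ j) atTop (𝓝 0) := by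
    have h1 := tendsto_self_mul_const_pow_of_lt_one hq0.le hq1
    have h2 := tendsto_pow_atTop_nhds_zero_of_lt_one hq0.le hq1
    have := h1.add h2
    simp only [add_zero] at this
    refine this.congr fun j => by ring
  set v : ℕ → ℝ := fun k => (L ^ (-z)) ^ k with hv
  have hvq0 : 0 < L ^ (-z) := Real.rpow_pos_of_pos hL0 _
  have hvq1 : L ^ (-z) < 1 := Real.rpow_lt_one_of_one_lt_of_neg hL1 (by linarith)
  set w : ℕ → ℝ := fun k => (L ^ (2 * α)) ^ (1 - r) * ((L ^ (-(α * (1 - r)))) ^ k) with hw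
  have hwq0 : 0 < L ^ (-(α * (1 - r))) := Real.rpow_pos_of_pos hL0 _
  have hwq1 : L ^ (-(α * (1 - r))) < 1 := Real.rpow_lt_one_of_one_lt_of_neg hL1 (by nlinarith)
  -- thresholds
  set δ : ℝ := a / (64 * (C₂ + 2 * C₃ + ĉ)) with hδ
  have hδ0 : 0 < δ := by positivity
  obtain ⟨J₁, hJ₁⟩ := exists_forall_ge_le_of_tendsto_zero hu hδ0
  obtain ⟨J₂, hJ₂⟩ := exists_forall_ge_le_of_tendsto_zero (tendsto_pow_atTop_nhds_zero_of_lt_one hvq0.le hvq1) hδ0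
  have hw0 : Tendsto (fun k : ℕ => (L ^ (2 * α)) ^ (1 - r) * (L ^ (-(α * (1 - r)))) ^ k) atTop (𝓝 0) := by
    have h := (tendsto_pow_atTop_nhds_zero_of_lt_one hwq0.le hwq1).const_mul ((L ^ (2 * α)) ^ (1 - r))
    rwa [mul_zero] at h
  obtain ⟨J₃, hJ₃⟩ := exists_forall_ge_le_of_tendsto_zero hw0 hδ0
  set JL : ℕ := max 2 (max J₁ (max J₂ J₃)) with hJL
  have hJL2 : 2 ≤ JL := le_max_left _ _
  have hJL₁ : J₁ ≤ JL := le_trans (le_max_left _ _) (le_max_right _ _)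
  have hJL₂ : J₂ ≤ JL := le_trans (le_trans (le_max_left _ _) (le_max_right _ _)) (le_max_right _ _)
  have hJL₃ : J₃ ≤ JL := le_trans (le_trans (le_max_right _ _) (le_max_right _ _)) (le_max_right _ _)
  refine ⟨JL, c₅ + a, by positivity, fun m2 hmpos hm1 j => ?_⟩
  obtain ⟨-, -, -, hβW, -⟩ := hcore m2 hmpos.le hm1 j
  have hM : PT.massFactor L α m2 j ≤ 1 := PT.massFactor_le_one hL0 α hmpos.le j
  have hcrude : |PT.betaWCoeff d n L α m2 j - a| ≤ c₅ + a := by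
    calc |PT.betaWCoeff d n L α m2 j - a| ≤ |PT.betaWCoeff d n L α m2 j| + |a| := abs_sub _ _
      _ ≤ c₅ + a := by
          rw [abs_of_pos ha]
          exact add_le_add (hβW.trans (mul_le_of_le_one_right hc₅.le hM)) le_rfl
  refine ⟨hcrude, fun hjJL hjJ => ?_⟩
  set J : ℕ := massScale L α m2 with hJ
  have hj1 : 1 ≤ j := by omega
  have hjJ1 : j + 1 ≤ J := by omega
  -- the rescaled mass at scale `j` is at most `L^{α(2+j-J)} ≤ 1`
  obtain ⟨-, hB2⟩ := massArg_massScale_bounds hL1 hα0 hmpos hm1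
  rw [← hJ] at hB2
  have hmul : ∀ a b : ℝ, L ^ a * L ^ b = L ^ (a + b) := fun a b => (Real.rpow_add hL0 a b).symm
  have hAj : m2 * (L ^ j) ^ α ≤ L ^ (2 * α) * (L ^ (-(α : ℝ))) ^ (J - j) := by
    rw [massArg_eq hL0 α m2 j J]
    calc m2 * (L ^ J) ^ α * L ^ (α * ((j : ℝ) - J)) ≤ L ^ (2 * α) * L ^ (α * ((j : ℝ) - J)) :=
          mul_le_mul_of_nonneg_right hB2 (Real.rpow_pos_of_pos hL0 _).le
      _ = L ^ (2 * α) * (L ^ (-(α : ℝ))) ^ (J - j) := by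
          rw [← Real.rpow_mul_natCast hL0.le]; congr 2; push_cast [Nat.cast_sub (by omega : j ≤ J)]; ring
  have hAj1 : m2 * (L ^ j) ^ α ≤ 1 := by
    refine hAj.trans ?_
    have hJj : 2 ≤ J - j := by omega
    calc L ^ (2 * α) * (L ^ (-(α : ℝ))) ^ (J - j) ≤ L ^ (2 * α) * (L ^ (-(α : ℝ))) ^ 2 := by
          refine mul_le_mul_of_nonneg_left ?_ (Real.rpow_pos_of_pos hL0 _).le
          exact pow_le_pow_of_le_one (Real.rpow_pos_of_pos hL0 _).le
            (Real.rpow_le_one_of_one_le_of_nonpos hL1.le (by linarith)) hJj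
      _ = 1 := by
          rw [← Real.rpow_mul_natCast hL0.le, hmul]
          convert Real.rpow_zero L using 2
          push_cast; ring
  have hA0 : 0 < m2 * (L ^ j) ^ α := mul_pos hmpos (Real.rpow_pos_of_pos (pow_pos hL0 j) _)
  -- the three pieces
  have h1 := h523 m2 hmpos hm1 j hj1 hjJ1
  have h2 := abs_betaCoeff_sub_massless_le hd n hα0 hα2 hL hc hr hD hmpos hm1 hAj1
  have h3 := h522 j hj1
  rw [← hJ] at h1
  -- smallness of each
  have hqj : (L ^ j) ^ (-m) = q ^ j := PT.pow_rpow_comm hL0.le j (-m)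
  have hu' : ((j : ℝ) + 1) * (L ^ j) ^ (-m) ≤ δ := by rw [hqj]; exact hJ₁ j (le_trans hJL₁ hjJL)
  have hv' : (L ^ (J - j) : ℝ) ^ (-z) ≤ δ := by
    have e : (L ^ (J - j) : ℝ) ^ (-z) = (L ^ (-z)) ^ (J - j) := PT.pow_rpow_comm hL0.le (J - j) (-z)
    rw [e]
    refine le_trans ?_ (hJ₂ J₂ le_rfl)
    exact pow_le_pow_of_le_one hvq0.le hvq1.le (by omega)
  have hw' : ĉ * (m2 * (L ^ j) ^ α) ^ (1 - r) ≤ ĉ * δ := by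
    refine mul_le_mul_of_nonneg_left ?_ hĉ0.le
    calc (m2 * (L ^ j) ^ α) ^ (1 - r) ≤ (L ^ (2 * α) * (L ^ (-(α : ℝ))) ^ (J - j)) ^ (1 - r) :=
          Real.rpow_le_rpow hA0.le hAj h1r.le
      _ = (L ^ (2 * α)) ^ (1 - r) * (L ^ (-(α * (1 - r)))) ^ (J - j) := by
          have hp0 : 0 ≤ (L ^ (-(α : ℝ))) ^ (J - j) := pow_nonneg (Real.rpow_pos_of_pos hL0 _).le _
          rw [Real.mul_rpow (Real.rpow_pos_of_pos hL0 _).le hp0]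
          congr 1
          rw [← Real.rpow_mul_natCast hL0.le, ← Real.rpow_mul hL0.le, ← Real.rpow_mul_natCast hL0.le]
          congr 1; ring
      _ ≤ (L ^ (2 * α)) ^ (1 - r) * (L ^ (-(α * (1 - r)))) ^ J₃ := by
          refine mul_le_mul_of_nonneg_left ?_ (Real.rpow_pos_of_pos (Real.rpow_pos_of_pos hL0 _) _).le
          exact pow_le_pow_of_le_one hwq0.le hwq1.le (by omega)
      _ ≤ δ := hJ₃ J₃ le_rfl
  -- assemble
  have hsum : C₂ * δ + C₃ * (δ + δ) + ĉ * δ = a / 64 := by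
    rw [hδ]; field_simp; ring
  calc |PT.betaWCoeff d n L α m2 j - a|
      ≤ |PT.betaWCoeff d n L α m2 j - PT.betaCoeff d n L α m2 j| +
          |PT.betaCoeff d n L α m2 j - PT.betaCoeff d n L α 0 j| + |PT.betaCoeff d n L α 0 j - a| := by
        have := abs_sub_le (PT.betaWCoeff d n L α m2 j) (PT.betaCoeff d n L α m2 j) a
        have := abs_sub_le (PT.betaCoeff d n L α m2 j) (PT.betaCoeff d n L α 0 j) a
        linarith
    _ ≤ C₃ * ((j + 1) * (L ^ j) ^ (-m) + (L ^ (J - j) : ℝ) ^ (-z)) + ĉ * (m2 * (L ^ j) ^ α) ^ (1 - r) +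
          C₂ * (j + 1) * (L ^ j) ^ (-m) := add_le_add (add_le_add h1 h2) h3
    _ ≤ C₃ * (δ + δ) + ĉ * δ + C₂ * δ := by
        refine add_le_add (add_le_add (mul_le_mul_of_nonneg_left (add_le_add hu' hv') hC₃.le) hw') ?_
        rw [mul_assoc]; exact mul_le_mul_of_nonneg_left hu' hC₂.le
    _ = a / 64 := by rw [← hsum]; ring

/-- **Lemma 5.2.4 for `d = 1`** (`α ∈ (½,1)`): the input (5.23) is `PT.Slade2017_lem521_massDeriv_d1`
(`r = 2 - 1/α < 1`). [cite: Slade2017, Lemma 5.2.4 and Lemma 5.2.1 (display (5.23), d = 1)] -/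
theorem Slade2017_lem524_d1 (n : ℕ) {α : ℝ} (hα0 : 1 / 2 < α) (hα1 : α < 1) {L : ℝ} (hL : 2 ≤ L) :
    ∃ JL : ℕ, ∃ bL : ℝ, 0 < bL ∧ ∀ m2 : ℝ, 0 < m2 → m2 ≤ 1 → ∀ j : ℕ,
      |PT.betaWCoeff 1 n L α m2 j - aCoeff 1 n L α| ≤ bL ∧
      (JL ≤ j → j + JL ≤ massScale L α m2 →
        |PT.betaWCoeff 1 n L α m2 j - aCoeff 1 n L α| ≤ aCoeff 1 n L α / 64) := by
  obtain ⟨c, hc, hD⟩ := PT.Slade2017_lem521_massDeriv_d1 n hα0 hα1 hL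
  have hα : 0 < α := by linarith
  have hr : 2 - 1 / α < 1 := by
    have : 1 < 1 / α := by rw [lt_div_iff₀ hα]; linarith
    linarith
  exact Slade2017_lem524 le_rfl n hα (by linarith) (by exact_mod_cast hα1) hL hc hr hD

/-- **Lemma 5.2.4 for `d = 2`** (`α ∈ (1,2)`): the input (5.23) is `PT.Slade2017_lem521_massDeriv_d2`
with `θ = (2-α)/4`, so `r = 2 - 2/α + 2θ/α < 1`. [cite: Slade2017, Lemma 5.2.4 and Lemma 5.2.1 (display (5.23), d = 2)] -/
theorem Slade2017_lem524_d2 (n : ℕ) {α : ℝ} (hα1 : 1 < α) (hα2 : α < 2) {L : ℝ} (hL : 2 ≤ L) :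
    ∃ JL : ℕ, ∃ bL : ℝ, 0 < bL ∧ ∀ m2 : ℝ, 0 < m2 → m2 ≤ 1 → ∀ j : ℕ,
      |PT.betaWCoeff 2 n L α m2 j - aCoeff 2 n L α| ≤ bL ∧
      (JL ≤ j → j + JL ≤ massScale L α m2 →
        |PT.betaWCoeff 2 n L α m2 j - aCoeff 2 n L α| ≤ aCoeff 2 n L α / 64) := by
  have hα : 0 < α := by linarith
  have hθ0 : 0 < (2 - α) / 4 := by linarith
  have hθ1 : (2 - α) / 4 ≤ 1 := by linarith
  have hθ1' : (2 - α) / 4 < 1 := by linarith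
  obtain ⟨c, hc, hD⟩ := PT.Slade2017_lem521_massDeriv_d2 n hα1 hα2 hθ0 hθ1 hθ1' hL
  have hr : 2 - 2 / α + 2 * ((2 - α) / 4) / α < 1 := by
    rw [show 2 - 2 / α + 2 * ((2 - α) / 4) / α = 2 - (1 + α / 2) / α by field_simp; ring]
    have : 1 < (1 + α / 2) / α := by rw [lt_div_iff₀ hα]; linarith
    linarith
  exact Slade2017_lem524 (by norm_num) n hα hα2 (by exact_mod_cast hα2) hL hc hr hD

/-- **Lemma 5.2.4 for `d ≥ 3`** (`α ∈ (1,2)`): the input (5.23) is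
`PT.Slade2017_lem521_massDeriv_dge3` (`r = 2 - 2/α < 1`). [cite: Slade2017, Lemma 5.2.4 and Lemma 5.2.1 (display (5.23), d = 3)] -/
theorem Slade2017_lem524_dge3 (hd : 3 ≤ d) (n : ℕ) {α : ℝ} (hα1 : 1 < α) (hα2 : α < 2) {L : ℝ} (hL : 2 ≤ L) :
    ∃ JL : ℕ, ∃ bL : ℝ, 0 < bL ∧ ∀ m2 : ℝ, 0 < m2 → m2 ≤ 1 → ∀ j : ℕ,
      |PT.betaWCoeff d n L α m2 j - aCoeff d n L α| ≤ bL ∧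
      (JL ≤ j → j + JL ≤ massScale L α m2 →
        |PT.betaWCoeff d n L α m2 j - aCoeff d n L α| ≤ aCoeff d n L α / 64) := by
  have hα : 0 < α := by linarith
  obtain ⟨c, hc, hD⟩ := PT.Slade2017_lem521_massDeriv_dge3 hd n hα1 hα2 hL
  have hr : 2 - 2 / α < 1 := by
    have : 1 < 2 / α := by rw [lt_div_iff₀ hα]; linarith
    linarith
  have hαd : α < d := by
    have : (3 : ℝ) ≤ d := by exact_mod_cast hd
    linarith
  exact Slade2017_lem524 (by omega) n hα hα2 hαd hL hc hr hD

end FRD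

end LongRangePhi4

end Literature.Barriers.CriticalPhenomena
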